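import Mathlib
import Literature.NumberTheory.LFunctions.Zhang2022.SkeletonMeanValue
import HarnessLib

/-!
# Zhang (2022) §7, proof of Proposition 7.1 part (c): the closing step
# "(7.20) ∧ (7.21) ∧ `i𝔯ⱼp^{−β_j} = w_j/α + O(𝓛)` ⇒ (7.10)" — DISCHARGED

Topic `Literature/NumberTheory/LFunctions/Zhang2022` (Landau–Siegel audit tree; verdict-neutral).
Y. Zhang, *Discrete mean estimates and the Landau–Siegel zero*, arXiv:2211.02515v1 (2022)
[Zhang2022LandauSiegel] — **an unrefereed manuscript under adjudication**. D-0069 campaign, cell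
`siegel-zhang`, layer L2. The last sentence of "*Proof of Proposition 7.1: The main term*" (§7 p. 42,
tex L2177): "Combining these [`i𝔯₁p^{−β₁} = 1/(2α) + O(𝓛)`, `i𝔯₂p^{−β₂} = 2/α + O(𝓛)`,
`i𝔯₃p^{−β₃} = 3/(2α) + O(𝓛)`] with (7.20) [`𝔗₁₁(p) = Σ_{1≤j≤3} 𝔯ⱼp^{1−β_j}S*ⱼ(𝐚₁,𝐚₂) + O(Pε₁)`,
`ε₁ = exp{−c𝓛^{1/10}}`] and (7.21) [`S*ⱼ = S_j`] we obtain (7.10)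
[`i𝔗₁₁(p) = (p/α)(½S₁ + 2S₂ + (3/2)S₃) + O(P𝓛²Σ_j|S_j|) + o(P)`]."

This file PROVES that inference as a kernel theorem, `eq710_of_eq720`, stated GENERICALLY in the three
objects the typed slice L2-t5 (`Section7dStatements`, p412033) introduces — `𝔗₁₁` (`Iface.frakT11`),
`S*ⱼ` (`SjStar`) and `𝔯ⱼ` (`frakr`) enter only through the displayed hypotheses, so they are universally
quantified functions `T`, `Sstar`, `𝔯` here; instantiating them gives, verbatim, the implication
`Eq720 c' → Eq721 c' → Step7u058 c' → Step7u059 c' → Step7u060 c' → Iface.Eq710 c'` between the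
typed nodes (the tail of the deduction node `DedProp71c`, DAG `Z22:Prop7.1.pf.c-main`; the one-line
bridge follows when p412033 lands). Everything else is the banked skeleton's (`Skeleton.Sj`, `betaJ`,
`beta1/2/3`, `alpha`, `ell`, `bigP`, `primeWindow`, `Adm72`, `ForAllLarge`, `AssumptionA`).
The content: `p^{1−β} = p·p^{−β}`, `p < 2P` on the window `p ∼ P`, `𝓛 ≤ 𝓛²` and `Pε₁ = o(P)`
(an explicit threshold `D₀`). Theorems only; 0 new definitions; 0 new facts.

WHAT THIS IS NOT: any claim about Theorems 1–2 of the manuscript or about Landau–Siegel zeros; not a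
discharge of (7.20) or of the residue evaluations themselves — only of the printed final inference.

## References

* Y. Zhang, arXiv:2211.02515v1 (2022), §7 pp. 37, 41–42: (7.10) tex L1973, (7.20) tex L2138,
  (7.21) tex L2165, the three residue displays tex L2169–L2176, closing sentence tex L2177.
  [cite: Zhang2022LandauSiegel, §7 pp. 41–42]
-/

noncomputable section

open Complex Finset

namespace Literature.NumberTheory.LFunctions.Zhang2022.Section7MainTerm

open Literature.NumberTheory.LFunctions.Zhang2022.Skeleton

/-! ## Small facts about the parameters -/

/-- On the prime window `p ∼ P` (`P < p < P(1 + 𝓛⁻⁶⁸)`), `p < 2P` once `𝓛 ≥ 1`.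
[cite: Zhang2022LandauSiegel, §2 p.4 (definition of `p ∼ P`)] -/
theorem lt_two_mul_bigP_of_mem_primeWindow {D p : ℕ} (hℓ : 1 ≤ ell D) (hp : p ∈ primeWindow D) :
    (p : ℝ) < 2 * bigP D := by
  rw [primeWindow, Finset.mem_filter, Finset.mem_Ioo] at hp
  have h1 : (p : ℝ) < bigP D * (1 + (ell D ^ 68)⁻¹) := Nat.lt_ceil.mp hp.1.2
  have h2 : (ell D ^ 68)⁻¹ ≤ 1 := inv_le_one_of_one_le₀ (one_le_pow₀ hℓ)
  have hP : 0 < bigP D := Real.exp_pos _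
  calc (p : ℝ) < bigP D * (1 + (ell D ^ 68)⁻¹) := h1
    _ ≤ bigP D * (1 + 1) := by gcongr
    _ = 2 * bigP D := by ring

/-- `𝓛 = log D ≥ L` as soon as `D ≥ ⌈exp L⌉`. [folklore] -/
private theorem le_ell_of_le {L : ℝ} {D : ℕ} (hD : ⌈Real.exp L⌉₊ ≤ D) : L ≤ ell D := by
  have hexp : Real.exp L ≤ D := le_trans (Nat.le_ceil _) (by exact_mod_cast hD)
  rw [ell]
  exact (Real.le_log_iff_exp_le (lt_of_lt_of_le (Real.exp_pos _) hexp)).mpr hexp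

/-- The `o(P)` of (7.10): `Kexp{−c𝓛^{1/10}} ≤ ε` for `D` large (explicit threshold). [folklore] -/
private theorem eps1_eventually (K c ε : ℝ) (hc : 0 < c) (hε : 0 < ε) :
    ∃ D₀ : ℕ, ∀ D : ℕ, D₀ ≤ D →
      1 ≤ ell D ∧ K * Real.exp (-(c * ell D ^ ((1 : ℝ) / 10))) ≤ ε := by
  set K' : ℝ := max K 1 with hK'
  have hK'pos : 0 < K' := lt_of_lt_of_le one_pos (le_max_right _ _)
  set L₁ : ℝ := (max 0 (Real.log (K' / ε) / c)) ^ 10 with hL₁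
  refine ⟨⌈Real.exp (max 1 L₁)⌉₊, fun D hD => ?_⟩
  have hℓ : max 1 L₁ ≤ ell D := le_ell_of_le hD
  have hℓ1 : 1 ≤ ell D := le_trans (le_max_left _ _) hℓ
  have hℓL : L₁ ≤ ell D := le_trans (le_max_right _ _) hℓ
  refine ⟨hℓ1, ?_⟩
  have hroot : max 0 (Real.log (K' / ε) / c) ≤ ell D ^ ((1 : ℝ) / 10) := by
    have h0 : 0 ≤ max 0 (Real.log (K' / ε) / c) := le_max_left _ _
    calc max 0 (Real.log (K' / ε) / c)
        = (L₁) ^ ((10 : ℕ)⁻¹ : ℝ) := (Real.pow_rpow_inv_natCast h0 (by norm_num)).symm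
      _ = L₁ ^ ((1 : ℝ) / 10) := by norm_num
      _ ≤ ell D ^ ((1 : ℝ) / 10) :=
          Real.rpow_le_rpow (by positivity) hℓL (by norm_num)
  have hlog : Real.log (K' / ε) ≤ c * ell D ^ ((1 : ℝ) / 10) := by
    have := le_trans (le_max_right _ _) hroot
    rwa [div_le_iff₀ hc, mul_comm] at this
  have hexp : Real.exp (-(c * ell D ^ ((1 : ℝ) / 10))) ≤ ε / K' := by
    calc Real.exp (-(c * ell D ^ ((1 : ℝ) / 10))) ≤ Real.exp (-Real.log (K' / ε)) :=
          Real.exp_le_exp.mpr (neg_le_neg hlog)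
      _ = ε / K' := by rw [Real.exp_neg, Real.exp_log (div_pos hK'pos hε), inv_div]
  calc K * Real.exp (-(c * ell D ^ ((1 : ℝ) / 10)))
      ≤ K' * Real.exp (-(c * ell D ^ ((1 : ℝ) / 10))) :=
        mul_le_mul_of_nonneg_right (le_max_left _ _) (Real.exp_pos _).le
    _ ≤ K' * (ε / K') := mul_le_mul_of_nonneg_left hexp hK'pos.le
    _ = ε := mul_div_cancel₀ _ hK'pos.ne'

/-- `Σ_{j ∈ [1,3]} f(j) = f(1) + f(2) + f(3)`. [folklore] -/
private theorem sum_Icc_one_three (f : ℕ → ℂ) : ∑ j ∈ Finset.Icc 1 3, f j = f 1 + f 2 + f 3 := by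
  have hIcc : Finset.Icc 1 3 = ({1, 2, 3} : Finset ℕ) := by decide
  rw [hIcc, Finset.sum_insert (by decide), Finset.sum_insert (by decide), Finset.sum_singleton,
    add_assoc]

/-! ## The closing inference of Proposition 7.1 part (c) -/

/-- **(7.20) ∧ (7.21) ∧ the three residue evaluations ⇒ (7.10)** (§7 p. 42: "Combining these with
(7.20) and (7.21) we obtain (7.10), and complete the proof of Proposition 7.1"), as a kernel theorem
generic in `𝔗₁₁` (`T`), `S*ⱼ` (`Sstar`) and `𝔯ⱼ` (`𝔯`): from
`𝔗₁₁(p) = Σ_{1≤j≤3} 𝔯ⱼp^{1−β_j}S*ⱼ + O(Pexp{−c𝓛^{1/10}})` (shape of `Eq720`), `S*ⱼ = S_j` under (7.2)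
(shape of `Eq721`), and `i𝔯ⱼp^{−β_j} = w_j/α + O(𝓛)`, `(w₁,w₂,w₃) = (½, 2, 3/2)` (shapes of
`Step7u058`–`Step7u060`), it follows that
`i𝔗₁₁(p) = (p/α)(½S₁ + 2S₂ + (3/2)S₃) + O(P𝓛²Σ_j|S_j|) + o(P)` for `p ∼ P` (shape of `Iface.Eq710`):
indeed `i𝔗₁₁ − (p/α)Σw_jS_j = i·O(Pε₁) + pΣ_j(i𝔯ⱼp^{−β_j} − w_j/α)S_j` with `p^{1−β} = p·p^{−β}`,
`p < 2P`, `𝓛 ≤ 𝓛²`, and `Pε₁ ≤ εP` for `D ≥ D₀(ε)`.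
[cite: Zhang2022LandauSiegel, §7 (7.10) p.37 tex L1973, p.42 tex L2169–L2177] -/
theorem eq710_of_eq720 (c' : ℝ) (T : ℕ → (ℕ → ℂ) → (ℕ → ℂ) → ℕ → ℂ)
    (Sstar : ℕ → ℕ → (ℕ → ℂ) → (ℕ → ℂ) → ℂ) (𝔯 : ℕ → ℕ → ℂ)
    (h720 : ∀ B : ℝ, ∃ c : ℝ, 0 < c ∧ ∃ C : ℝ, ForAllLarge fun D _ χ => AssumptionA D χ →
      ∀ a₁ a₂ : ℕ → ℂ, Adm72 D B a₁ → Adm72 D B a₂ → ∀ p ∈ primeWindow D,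
        ‖T D a₁ a₂ p -
            ∑ j ∈ Finset.Icc 1 3, 𝔯 D j * (p : ℂ) ^ (1 - betaJ c' D j) * Sstar D j a₁ a₂‖
          ≤ C * (bigP D * Real.exp (-(c * ell D ^ ((1 : ℝ) / 10)))))
    (h721 : ∀ (D : ℕ) (B : ℝ) (j : ℕ) (a₁ a₂ : ℕ → ℂ), Adm72 D B a₁ → Adm72 D B a₂ →
      Sstar D j a₁ a₂ = Sj c' D j a₁ a₂)
    (h58 : ∃ C : ℝ, ForAllLarge fun D _ χ => AssumptionA D χ → ∀ p ∈ primeWindow D,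
      ‖I * 𝔯 D 1 * (p : ℂ) ^ (-beta1 c' D) - 1 / (2 * (alpha D : ℂ))‖ ≤ C * ell D)
    (h59 : ∃ C : ℝ, ForAllLarge fun D _ χ => AssumptionA D χ → ∀ p ∈ primeWindow D,
      ‖I * 𝔯 D 2 * (p : ℂ) ^ (-beta2 c' D) - 2 / (alpha D : ℂ)‖ ≤ C * ell D)
    (h60 : ∃ C : ℝ, ForAllLarge fun D _ χ => AssumptionA D χ → ∀ p ∈ primeWindow D,
      ‖I * 𝔯 D 3 * (p : ℂ) ^ (-beta3 c' D) - 3 / (2 * (alpha D : ℂ))‖ ≤ C * ell D) :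
    ∀ B : ℝ, ∀ ε : ℝ, 0 < ε → ∃ C : ℝ, ForAllLarge fun D _ χ => AssumptionA D χ →
      ∀ a₁ a₂ : ℕ → ℂ, Adm72 D B a₁ → Adm72 D B a₂ → ∀ p ∈ primeWindow D,
        ‖I * T D a₁ a₂ p -
            (p : ℂ) / (alpha D : ℂ) *
              (1 / 2 * Sj c' D 1 a₁ a₂ + 2 * Sj c' D 2 a₁ a₂ + 3 / 2 * Sj c' D 3 a₁ a₂)‖
          ≤ C * bigP D * ell D ^ 2 *
              (‖Sj c' D 1 a₁ a₂‖ + ‖Sj c' D 2 a₁ a₂‖ + ‖Sj c' D 3 a₁ a₂‖) + ε * bigP D := by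
  intro B ε hε
  obtain ⟨c, hc, C₁, h720'⟩ := h720 B
  obtain ⟨C₂, h58'⟩ := h58
  obtain ⟨C₃, h59'⟩ := h59
  obtain ⟨C₄, h60'⟩ := h60
  set M : ℝ := |C₂| + |C₃| + |C₄| with hM
  have hM0 : 0 ≤ M := by positivity
  refine ⟨2 * M, ?_⟩
  obtain ⟨D₀, hD₀⟩ := eps1_eventually C₁ c ε hc hε
  have hev : ForAllLarge fun D _ _ =>
      1 ≤ ell D ∧ C₁ * Real.exp (-(c * ell D ^ ((1 : ℝ) / 10))) ≤ ε :=
    ForAllLarge.of_le D₀ fun D _ _ hD _ _ => hD₀ D hD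
  refine ((h720'.and (h58'.and (h59'.and h60'))).and hev).mono ?_
  intro D _ χ _ _ h hA a₁ a₂ ha₁ ha₂ p hp
  obtain ⟨⟨hT, hr1, hr2, hr3⟩, hℓ1, hε₁⟩ := h
  -- shorthands
  set S₁ : ℂ := Sj c' D 1 a₁ a₂ with hS₁
  set S₂ : ℂ := Sj c' D 2 a₁ a₂ with hS₂
  set S₃ : ℂ := Sj c' D 3 a₁ a₂ with hS₃
  set u₁ : ℂ := I * 𝔯 D 1 * (p : ℂ) ^ (-beta1 c' D) - 1 / (2 * (alpha D : ℂ)) with hu₁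
  set u₂ : ℂ := I * 𝔯 D 2 * (p : ℂ) ^ (-beta2 c' D) - 2 / (alpha D : ℂ) with hu₂
  set u₃ : ℂ := I * 𝔯 D 3 * (p : ℂ) ^ (-beta3 c' D) - 3 / (2 * (alpha D : ℂ)) with hu₃
  set e₀ : ℂ := T D a₁ a₂ p -
      ∑ j ∈ Finset.Icc 1 3, 𝔯 D j * (p : ℂ) ^ (1 - betaJ c' D j) * Sstar D j a₁ a₂ with he₀
  have hT' : ‖e₀‖ ≤ C₁ * (bigP D * Real.exp (-(c * ell D ^ ((1 : ℝ) / 10)))) :=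
    hT hA a₁ a₂ ha₁ ha₂ p hp
  have hu1 : ‖u₁‖ ≤ C₂ * ell D := hr1 hA p hp
  have hu2 : ‖u₂‖ ≤ C₃ * ell D := hr2 hA p hp
  have hu3 : ‖u₃‖ ≤ C₄ * ell D := hr3 hA p hp
  -- the prime `p` and the parameters
  have hpP : (p : ℝ) < 2 * bigP D := lt_two_mul_bigP_of_mem_primeWindow hℓ1 hp
  have hp_prime : p.Prime := (Finset.mem_filter.mp hp).2
  have hp0 : (p : ℂ) ≠ 0 := by exact_mod_cast hp_prime.ne_zero
  have hP0 : 0 < bigP D := Real.exp_pos _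
  have hℓ0 : 0 ≤ ell D := le_trans zero_le_one hℓ1
  -- `p^{1−β} = p·p^{−β}` and the values of `β_j` at `j = 1, 2, 3`
  have hpow : ∀ β : ℂ, (p : ℂ) ^ (1 - β) = p * (p : ℂ) ^ (-β) := fun β => by
    rw [sub_eq_add_neg, Complex.cpow_add _ _ hp0, Complex.cpow_one]
  have hb1 : betaJ c' D 1 = beta1 c' D := by simp [betaJ]
  have hb2 : betaJ c' D 2 = beta2 c' D := by simp [betaJ]
  have hb3 : betaJ c' D 3 = beta3 c' D := by simp [betaJ]
  -- the sum over `j` written out, with `S*ⱼ = S_j`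
  have hsum : ∑ j ∈ Finset.Icc 1 3, 𝔯 D j * (p : ℂ) ^ (1 - betaJ c' D j) * Sstar D j a₁ a₂ =
      p * (I * 𝔯 D 1 * (p : ℂ) ^ (-beta1 c' D)) * S₁ * (-I) +
        p * (I * 𝔯 D 2 * (p : ℂ) ^ (-beta2 c' D)) * S₂ * (-I) +
        p * (I * 𝔯 D 3 * (p : ℂ) ^ (-beta3 c' D)) * S₃ * (-I) := by
    rw [sum_Icc_one_three, hb1, hb2, hb3, hpow, hpow, hpow,
      h721 D B 1 a₁ a₂ ha₁ ha₂, h721 D B 2 a₁ a₂ ha₁ ha₂, h721 D B 3 a₁ a₂ ha₁ ha₂]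
    have hI : I * I = -1 := Complex.I_mul_I
    linear_combination (𝔯 D 1 * (p * (p : ℂ) ^ (-beta1 c' D)) * S₁ +
      𝔯 D 2 * (p * (p : ℂ) ^ (-beta2 c' D)) * S₂ +
      𝔯 D 3 * (p * (p : ℂ) ^ (-beta3 c' D)) * S₃) * hI
  -- the key algebraic identity
  have key : I * T D a₁ a₂ p - (p : ℂ) / (alpha D : ℂ) * (1 / 2 * S₁ + 2 * S₂ + 3 / 2 * S₃) =
      I * e₀ + p * (u₁ * S₁ + u₂ * S₂ + u₃ * S₃) := by
    have hTe : T D a₁ a₂ p = e₀ +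
        ∑ j ∈ Finset.Icc 1 3, 𝔯 D j * (p : ℂ) ^ (1 - betaJ c' D j) * Sstar D j a₁ a₂ := by
      rw [he₀]; ring
    rw [hTe, hsum, hu₁, hu₂, hu₃]
    have hI : I * I = -1 := Complex.I_mul_I
    linear_combination (-I * ((p : ℂ) * 𝔯 D 1 * (p : ℂ) ^ (-beta1 c' D) * S₁ +
      (p : ℂ) * 𝔯 D 2 * (p : ℂ) ^ (-beta2 c' D) * S₂ +
        (p : ℂ) * 𝔯 D 3 * (p : ℂ) ^ (-beta3 c' D) * S₃)) * hI
  -- the estimate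
  have hp_norm : ‖(p : ℂ)‖ = (p : ℝ) := by simp
  have hpos : 0 ≤ (p : ℝ) := Nat.cast_nonneg p
  have h1 : ‖I * e₀‖ ≤ ε * bigP D := by
    rw [norm_mul, Complex.norm_I, one_mul]
    refine hT'.trans ?_
    calc C₁ * (bigP D * Real.exp (-(c * ell D ^ ((1 : ℝ) / 10))))
        = (C₁ * Real.exp (-(c * ell D ^ ((1 : ℝ) / 10)))) * bigP D := by ring
      _ ≤ ε * bigP D := mul_le_mul_of_nonneg_right hε₁ hP0.le
  have h2 : ‖(p : ℂ) * (u₁ * S₁ + u₂ * S₂ + u₃ * S₃)‖ ≤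
      2 * M * bigP D * ell D ^ 2 * (‖S₁‖ + ‖S₂‖ + ‖S₃‖) := by
    rw [norm_mul, hp_norm]
    have hin : ‖u₁ * S₁ + u₂ * S₂ + u₃ * S₃‖ ≤ M * ell D * (‖S₁‖ + ‖S₂‖ + ‖S₃‖) := by
      calc ‖u₁ * S₁ + u₂ * S₂ + u₃ * S₃‖
          ≤ ‖u₁ * S₁‖ + ‖u₂ * S₂‖ + ‖u₃ * S₃‖ := norm_add₃_le
        _ = ‖u₁‖ * ‖S₁‖ + ‖u₂‖ * ‖S₂‖ + ‖u₃‖ * ‖S₃‖ := by simp only [norm_mul]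
        _ ≤ |C₂| * ell D * ‖S₁‖ + |C₃| * ell D * ‖S₂‖ + |C₄| * ell D * ‖S₃‖ := by
            gcongr
            · exact hu1.trans (mul_le_mul_of_nonneg_right (le_abs_self _) hℓ0)
            · exact hu2.trans (mul_le_mul_of_nonneg_right (le_abs_self _) hℓ0)
            · exact hu3.trans (mul_le_mul_of_nonneg_right (le_abs_self _) hℓ0)
        _ ≤ M * ell D * (‖S₁‖ + ‖S₂‖ + ‖S₃‖) := by
            rw [hM]
            have h1 : 0 ≤ |C₂| * ell D := mul_nonneg (abs_nonneg _) hℓ0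
            have h2 : 0 ≤ |C₃| * ell D := mul_nonneg (abs_nonneg _) hℓ0
            have h3 : 0 ≤ |C₄| * ell D := mul_nonneg (abs_nonneg _) hℓ0
            nlinarith [mul_nonneg h1 (norm_nonneg S₂), mul_nonneg h1 (norm_nonneg S₃),
              mul_nonneg h2 (norm_nonneg S₁), mul_nonneg h2 (norm_nonneg S₃),
              mul_nonneg h3 (norm_nonneg S₁), mul_nonneg h3 (norm_nonneg S₂)]
    have hℓsq : ell D ≤ ell D ^ 2 := by
      calc ell D = ell D * 1 := (mul_one _).symm
        _ ≤ ell D * ell D := mul_le_mul_of_nonneg_left hℓ1 hℓ0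
        _ = ell D ^ 2 := (sq _).symm
    have hS : 0 ≤ ‖S₁‖ + ‖S₂‖ + ‖S₃‖ := by positivity
    calc (p : ℝ) * ‖u₁ * S₁ + u₂ * S₂ + u₃ * S₃‖
        ≤ (2 * bigP D) * (M * ell D * (‖S₁‖ + ‖S₂‖ + ‖S₃‖)) :=
          mul_le_mul hpP.le hin (norm_nonneg _) (by positivity)
      _ ≤ (2 * bigP D) * (M * ell D ^ 2 * (‖S₁‖ + ‖S₂‖ + ‖S₃‖)) := by gcongr
      _ = 2 * M * bigP D * ell D ^ 2 * (‖S₁‖ + ‖S₂‖ + ‖S₃‖) := by ring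
  rw [key]
  calc ‖I * e₀ + (p : ℂ) * (u₁ * S₁ + u₂ * S₂ + u₃ * S₃)‖
      ≤ ‖I * e₀‖ + ‖(p : ℂ) * (u₁ * S₁ + u₂ * S₂ + u₃ * S₃)‖ := norm_add_le _ _
    _ ≤ ε * bigP D + 2 * M * bigP D * ell D ^ 2 * (‖S₁‖ + ‖S₂‖ + ‖S₃‖) := add_le_add h1 h2
    _ = 2 * M * bigP D * ell D ^ 2 * (‖S₁‖ + ‖S₂‖ + ‖S₃‖) + ε * bigP D := add_comm _ _

end Literature.NumberTheory.LFunctions.Zhang2022.Section7MainTerm
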